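import Summits.QuantumFields.QCD.Theses.GaussianLinkFrames
import Summits.QuantumFields.QCD.Theorems.WilsonMobilityGapPhaseQuenchedFlavourDecayCoreDefs
import Summits.QuantumFields.QCD.Theorems.PauliWegnerSeaPhaseQuenchedFlavourDecayUniformReduction

/-!
# Crux `PhaseQuenchedFlavourDecay` (stmt-QuantumFields-9151) from the named open core `UniformMinorMoments`
(line `crossing-split-integrability`, lead c13, 2026-08-17)

The three byte-identical route copies of the crux —
`Summit.QuantumFields.QCD.Theses.{WilsonMobilityGap, PauliWegnerSea, GaussianLinkFrames}.PhaseQuenchedFlavourDecay` —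
follow from the `@[conjecture]` node `PhaseQuenchedFlavourDecayCore.UniformMinorMoments`
(`Theorems/WilsonMobilityGapPhaseQuenchedFlavourDecayCoreDefs.lean`, p158678) by the LANDED reduction chain of the line:
`uniformMinorMoments_iff` (unfolding) → `stub_minorMomentsCore_of_uniform` (p122368: `a_k → 0`, `a_k L_k → ∞` put every
large `k` in the uniform regime) → `phaseQuenchedFlavourDecay_of_aprioriMinorMoments` (p105597: two-point transport, crossing
Laplace expansion, split bound, decay transfer, Wick expansion and summation — the six landed stubs of skeleton r3).
These are the conditional closers BY NAME: the crux is kernel-closed modulo the single named conjecture, and nothing else.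
All three statements are registered sub-goals of the crux item.
-/

noncomputable section

namespace Summit.QuantumFields.QCD.Theorems.PhaseQuenchedFlavourDecayCore

open Summit.QuantumFields.QCD.Cruxes.PhaseQuenchedFlavourDecay.CrossingSplitIntegrability

/-- **Route WilsonMobilityGap's copy of the crux from the named open core** (registered sub-goal
`wmgPhaseQuenchedFlavourDecay_of_core`): `UniformMinorMoments → WilsonMobilityGap.PhaseQuenchedFlavourDecay`. -/
theorem wmgPhaseQuenchedFlavourDecay_of_core : Summit.QuantumFields.QCD.Theorems.PhaseQuenchedFlavourDecayCore.UniformMinorMoments → Summit.QuantumFields.QCD.Theses.WilsonMobilityGap.PhaseQuenchedFlavourDecay :=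
  fun h => wmgPhaseQuenchedFlavourDecay_of_uniformMinorMoments (uniformMinorMoments_iff.1 h)

/-- **Route PauliWegnerSea's copy of the crux from the named open core** (registered sub-goal
`pwsPhaseQuenchedFlavourDecay_of_core`): `UniformMinorMoments → PauliWegnerSea.PhaseQuenchedFlavourDecay`. -/
theorem pwsPhaseQuenchedFlavourDecay_of_core : Summit.QuantumFields.QCD.Theorems.PhaseQuenchedFlavourDecayCore.UniformMinorMoments → Summit.QuantumFields.QCD.Theses.PauliWegnerSea.PhaseQuenchedFlavourDecay :=
  fun h => phaseQuenchedFlavourDecay_of_uniformMinorMoments (uniformMinorMoments_iff.1 h)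

/-- **Route GaussianLinkFrames' copy of the crux from the named open core** (registered sub-goal
`glfPhaseQuenchedFlavourDecay_of_core`): `UniformMinorMoments → GaussianLinkFrames.PhaseQuenchedFlavourDecay`
(the GaussianLinkFrames copy is the same proposition as the WilsonMobilityGap copy, by `Iff.rfl`). -/
theorem glfPhaseQuenchedFlavourDecay_of_core : Summit.QuantumFields.QCD.Theorems.PhaseQuenchedFlavourDecayCore.UniformMinorMoments → Summit.QuantumFields.QCD.Theses.GaussianLinkFrames.PhaseQuenchedFlavourDecay :=
  fun h => (show Summit.QuantumFields.QCD.Theses.GaussianLinkFrames.PhaseQuenchedFlavourDecay ↔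
      Summit.QuantumFields.QCD.Theses.WilsonMobilityGap.PhaseQuenchedFlavourDecay from Iff.rfl).2
    (wmgPhaseQuenchedFlavourDecay_of_core h)

end Summit.QuantumFields.QCD.Theorems.PhaseQuenchedFlavourDecayCore

end
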